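import Mathlib
import Summits.Ventures.PercRepro2.CrossAPrimeTwoRoutesSupp
import Summits.Ventures.PercRepro2.CrossAPrimeAvoidCrux
import Summits.Ventures.PercRepro2.RBRootEdge

/-!
# A two-route core plus one free `a₁`–`v` edge: the sign of `crossA′so` by MIXTURE + POLARISATION
(blind cell PercRepro2, p5 g36; S4 §2.4 (s) addendum 38 (3))

Let `π₁ ∋ o`, `π₂ ∋ b` be the two routes of `CrossAPrimeTwoRoutes` (hypotheses required only on
the configurations with `e` closed, `supp (p[e ↦ 0])`) and `e = {a₁, v}` a further edge of weight
`q = p e`.  Along `e` the constant functional is a quadratic (`crossC_pin_quadratic`),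
`crossC(p; C) = (1 − q)²·Φ⁰⁰ + q(1 − q)·(Φ⁰¹ + Φ¹⁰) + q²·Φ¹¹`, whose pieces are the two-copy
patterns of the pinned measures `p⁰ = p[e ↦ 0]` (the two-route law) and `p¹ = p[e ↦ 1]`.  Under
`p¹`, on `Q = {a₂ ↮ a₁}`, `v ∉ K` and `a₁ ↔ v` surely, so its six masses are the `v ∉ K` masses
`(s, u, w, u, w, τ)` of `p⁰` (`prob_update_one_mass`, `prob_update_one_route_mass`: the events
`{a₂ ↮ a₁, v} ∩ {·}` are determined off `e`).  With the constant `C = q + (1 − q)·π̃₁₂ ≤ π`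
(`const_le_pi`):
* `Φ⁰⁰ = crossC(p⁰; π̃₁₂) + q(1 − π̃₁₂)·x⁰y⁰ ≥ q(1 − π̃₁₂)·x⁰y⁰` (the two-route theorem on the
  support, `crossC_nonneg_of_twoRoutes_supp`);
* `Φ¹¹ = 2sτ − 2uw + C·uw ≥ C·uw` (BHK with the avoidance of `{a₁, v}`: `u·w ≤ τ·s`);
* `Φ⁰¹ + Φ¹⁰ ≥ uw·(2C − p₁ − p₂) − (1 − q)(1 − π̃₁₂)·(u·y_v + w·x_v)` (`xv⁰ ≤ p₂·u`,
  `yv⁰ ≤ p₁·w`, `Dv⁰ = 0`), and the slack of `Φ⁰⁰` absorbs the negative part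
  (`freeEdge_algebra`, an explicit certificate).
**`crossA'so_nonneg_of_twoRoutes_freeEdge`** is the theorem.  Own work; standard axioms.
-/

namespace Summit.Ventures.PercRepro2

open LeafRowPendantRootSO CrossAPrimeA2Route CrossAPrimeSupport CrossAPrimeTwoRoutes
  CrossAPrimeTwoRoutesSupp CrossAPrimeAvoidCrux

namespace CrossAPrimeFreeEdge

section Algebra

variable {R : Type*} [Field R] [LinearOrder R] [IsStrictOrderedRing R]

/-- **The algebra of the free edge.**  With `π̃ = P₁ + P₂ − P₁P₂`, `C = q + (1 − q)π̃`, the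
two-route crux of `p⁰` at `π̃` (`htwo`), `xv⁰ ≤ P₂u`, `yv⁰ ≤ P₁w`, `u ≤ x⁰`, `w ≤ y⁰`, `s ≤ Z⁰` and
BHK-avoid `u·w ≤ τ·s`, the quadratic `(1 − q)²Φ⁰⁰ + q(1 − q)(Φ⁰¹ + Φ¹⁰) + q²Φ¹¹` is nonnegative. -/
lemma freeEdge_algebra {q P₁ P₂ Z0 x0 y0 xv0 yv0 s u w τ : R} (hq0 : 0 ≤ q) (hq1 : q ≤ 1)
    (hP₁ : 0 ≤ P₁) (hP₁' : P₁ ≤ 1) (hP₂ : 0 ≤ P₂) (hP₂' : P₂ ≤ 1)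
    (hs : s ≤ Z0) (hu0 : 0 ≤ u) (hw0 : 0 ≤ w) (hτ0 : 0 ≤ τ)
    (hxu : u ≤ x0) (hyw : w ≤ y0)
    (hxv0 : xv0 ≤ P₂ * u) (hyv0 : yv0 ≤ P₁ * w)
    (hbhk : u * w ≤ τ * s)
    (htwo : 0 ≤ 2 * Z0 * 0 - y0 * xv0 + (P₁ + P₂ - P₁ * P₂) * x0 * y0 - x0 * yv0) :
    0 ≤ (1 - q) ^ 2 * (2 * Z0 * 0 - y0 * xv0 + (q + (1 - q) * (P₁ + P₂ - P₁ * P₂)) * x0 * y0 -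
          x0 * yv0) +
        q * (1 - q) *
          ((2 * Z0 * τ - y0 * u + (q + (1 - q) * (P₁ + P₂ - P₁ * P₂)) * x0 * w - x0 * w) +
            (2 * s * 0 - w * xv0 + (q + (1 - q) * (P₁ + P₂ - P₁ * P₂)) * u * y0 - u * yv0)) +
        q ^ 2 * (2 * s * τ - w * u + (q + (1 - q) * (P₁ + P₂ - P₁ * P₂)) * u * w - u * w) := by
  set pit := P₁ + P₂ - P₁ * P₂ with hpit
  set C := q + (1 - q) * pit with hC
  have hpit0 : 0 ≤ pit := by nlinarith
  have hpit1 : pit ≤ 1 := by nlinarith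
  have hC0 : 0 ≤ C := by nlinarith
  have h2C : 0 ≤ 2 * C - P₁ - P₂ := by nlinarith
  have hq' : 0 ≤ 1 - q := by linarith
  have hxv_ : 0 ≤ x0 - u := by linarith
  have hyv_ : 0 ≤ y0 - w := by linarith
  -- the certificate
  have key : (1 - q) ^ 2 * (2 * Z0 * 0 - y0 * xv0 + C * x0 * y0 - x0 * yv0) +
        q * (1 - q) * ((2 * Z0 * τ - y0 * u + C * x0 * w - x0 * w) +
          (2 * s * 0 - w * xv0 + C * u * y0 - u * yv0)) +
        q ^ 2 * (2 * s * τ - w * u + C * u * w - u * w) =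
      q * (1 - q) ^ 2 * (1 - pit) * (u * w + (x0 - u) * (y0 - w)) +
        q * (1 - q) * (u * w) * (2 * C - P₁ - P₂) + q ^ 2 * C * (u * w) +
        (1 - q) ^ 2 * (2 * Z0 * 0 - y0 * xv0 + pit * x0 * y0 - x0 * yv0) +
        q * (1 - q) * (2 * (Z0 - s) * τ + 2 * (τ * s - u * w) + w * (P₂ * u - xv0) +
          u * (P₁ * w - yv0)) +
        q ^ 2 * (2 * (τ * s - u * w)) := by
    rw [hC]; ring
  rw [key]
  have t1 : 0 ≤ q * (1 - q) ^ 2 * (1 - pit) * (u * w + (x0 - u) * (y0 - w)) :=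
    mul_nonneg (mul_nonneg (mul_nonneg hq0 (sq_nonneg _)) (by linarith))
      (add_nonneg (mul_nonneg hu0 hw0) (mul_nonneg hxv_ hyv_))
  have t2 : 0 ≤ q * (1 - q) * (u * w) * (2 * C - P₁ - P₂) :=
    mul_nonneg (mul_nonneg (mul_nonneg hq0 hq') (mul_nonneg hu0 hw0)) h2C
  have t3 : 0 ≤ q ^ 2 * C * (u * w) := mul_nonneg (mul_nonneg (sq_nonneg _) hC0) (mul_nonneg hu0 hw0)
  have t4 : 0 ≤ (1 - q) ^ 2 * (2 * Z0 * 0 - y0 * xv0 + pit * x0 * y0 - x0 * yv0) :=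
    mul_nonneg (sq_nonneg _) htwo
  have t5 : 0 ≤ q * (1 - q) * (2 * (Z0 - s) * τ + 2 * (τ * s - u * w) + w * (P₂ * u - xv0) +
      u * (P₁ * w - yv0)) := by
    refine mul_nonneg (mul_nonneg hq0 hq') ?_
    have a1 : 0 ≤ 2 * (Z0 - s) * τ := mul_nonneg (mul_nonneg (by norm_num) (by linarith)) hτ0
    have a2 : 0 ≤ 2 * (τ * s - u * w) := by linarith
    have a3 : 0 ≤ w * (P₂ * u - xv0) := mul_nonneg hw0 (by linarith)
    have a4 : 0 ≤ u * (P₁ * w - yv0) := mul_nonneg hu0 (by linarith)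
    linarith
  have t6 : 0 ≤ q ^ 2 * (2 * (τ * s - u * w)) := mul_nonneg (sq_nonneg _) (by linarith)
  linarith

end Algebra

section Masses

variable {V : Type*} {E : Type*} [Fintype E] [DecidableEq E] [DecidableEq V] {R : Type*} [Field R]
  [LinearOrder R] [IsStrictOrderedRing R]
variable {ends : E → Sym2 V}

omit [Fintype E] [DecidableEq E] [LinearOrder R] [IsStrictOrderedRing R] in
/-- `{a₂ ↮ a₁, v} = Q ∩ {v ∉ K}`. -/
lemma avoidAll_pair_eq (ends : E → Sym2 V) (a₁ a₂ v : V) :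
    avoidAll ends a₂ (insert a₁ {v}) = avoidAll ends a₂ {a₁} ∩ (connEvent ends a₂ v)ᶜ := by
  ext ω
  constructor
  · intro h
    refine ⟨fun x hx => h x (Finset.mem_insert.2 (Or.inl (Finset.mem_singleton.1 hx))), ?_⟩
    · intro hv
      exact h v (Finset.mem_insert_of_mem (Finset.mem_singleton_self v)) hv
  · rintro ⟨hQ, hv⟩ x hx
    rcases Finset.mem_insert.1 hx with rfl | hx
    · exact hQ x (Finset.mem_singleton_self x)
    · rw [Finset.mem_singleton] at hx
      rw [hx]
      exact hv

omit [Fintype E] [DecidableEq V] [LinearOrder R] [IsStrictOrderedRing R] in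
/-- On the support of `p[e ↦ 1]` the edge `e` is open. -/
lemma open_of_mem_supp_update_one (p : E → R) (e : E) {ω : Config E}
    (hω : ω ∈ supp (Function.update p e 1)) : ω e = true :=
  (hω e).1 (by simp)

omit [Fintype E] [DecidableEq V] [LinearOrder R] [IsStrictOrderedRing R] in
/-- On the support of `p[e ↦ 1]`, `e = {a₁, v}`, `a₁ ↔ v`. -/
lemma conn_of_mem_supp_update_one (p : E → R) {e : E} {a₁ v : V} (he : ends e = s(a₁, v))
    {ω : Config E} (hω : ω ∈ supp (Function.update p e 1)) : Conn ends ω a₁ v :=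
  conn_of_openAdj ⟨e, open_of_mem_supp_update_one p e hω, he⟩

omit [Fintype E] [LinearOrder R] [IsStrictOrderedRing R] in
/-- On the support of `p[e ↦ 1]`, `Q ∩ {a₁ ↔ v} ∩ A` and `Q ∩ A` are `{a₂ ↮ a₁, v} ∩ A`. -/
lemma inter_supp_update_one_eq (p : E → R) {e : E} {a₁ v : V} (he : ends e = s(a₁, v))
    (a₂ : V) (A : Set (Config E)) :
    avoidAll ends a₂ {a₁} ∩ (connEvent ends a₁ v ∩ A) ∩ supp (Function.update p e 1) =
        avoidAll ends a₂ (insert a₁ {v}) ∩ A ∩ supp (Function.update p e 1) ∧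
      avoidAll ends a₂ {a₁} ∩ A ∩ supp (Function.update p e 1) =
        avoidAll ends a₂ (insert a₁ {v}) ∩ A ∩ supp (Function.update p e 1) := by
  have key : ∀ ω ∈ supp (Function.update p e 1), ω ∈ avoidAll ends a₂ {a₁} →
      ω ∈ avoidAll ends a₂ (insert a₁ {v}) := by
    intro ω hω hQ x hx hc
    rcases Finset.mem_insert.1 hx with rfl | hx
    · exact hQ x (Finset.mem_singleton_self x) hc
    · rw [Finset.mem_singleton] at hx
      subst hx
      exact hQ a₁ (Finset.mem_singleton_self a₁)
        (conn_trans hc (conn_symm (conn_of_mem_supp_update_one p he hω)))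
  have back : ∀ ω, ω ∈ avoidAll ends a₂ (insert a₁ {v}) → ω ∈ avoidAll ends a₂ {a₁} :=
    fun ω h x hx => h x (by rw [Finset.mem_singleton] at hx; rw [hx]; exact Finset.mem_insert_self a₁ {v})
  constructor
  · ext ω
    simp only [Set.mem_inter_iff]
    constructor
    · rintro ⟨⟨hQ, -, hA⟩, hs⟩
      exact ⟨⟨key ω hs hQ, hA⟩, hs⟩
    · rintro ⟨⟨hQ', hA⟩, hs⟩
      exact ⟨⟨back ω hQ', conn_of_mem_supp_update_one p he hs, hA⟩, hs⟩
  · ext ω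
    simp only [Set.mem_inter_iff]
    constructor
    · rintro ⟨⟨hQ, hA⟩, hs⟩
      exact ⟨⟨key ω hs hQ, hA⟩, hs⟩
    · rintro ⟨⟨hQ', hA⟩, hs⟩
      exact ⟨⟨back ω hQ', hA⟩, hs⟩

omit [DecidableEq V] [LinearOrder R] [IsStrictOrderedRing R] in
/-- An event determined off `e` has the same probability under `p[e ↦ 1]` and `p[e ↦ 0]`. -/
lemma prob_update_one_eq_update_zero_of_dependsOn (p : E → R) (e : E) {S : Set (Config E)}
    (hS : DependsOn (· ∈ S) (({e} : Finset E) : Set E)ᶜ) :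
    prob (Function.update p e 1) S = prob (Function.update p e 0) S := by
  rw [RBRootEdge.prob_update_one_eq, RBRootEdge.prob_update_zero_eq]
  congr 1
  ext ω
  simp only [Set.mem_setOf_eq]
  refine dependsOn_mem_iff hS fun e' he' => ?_
  have hne : e' ≠ e := by
    simpa [Set.mem_compl_iff, Finset.coe_singleton] using he'
  rw [Function.update_of_ne hne, Function.update_of_ne hne]

omit [LinearOrder R] [IsStrictOrderedRing R] in
/-- **The masses of `p[e ↦ 1]`**, `e = {a₁, v}`: `P¹(Q ∩ {z ∈ K}) = P⁰(Q, v ∉ K, z ∈ K)` and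
`P¹(Q ∩ {a₁ ↔ v} ∩ {z ∈ K}) = P⁰(Q, v ∉ K, z ∈ K)`. -/
lemma prob_update_one_conn (p : E → R) {e : E} {a₁ v : V} (he : ends e = s(a₁, v)) (a₂ z : V) :
    prob (Function.update p e 1) (avoidAll ends a₂ {a₁} ∩ connEvent ends a₂ z) =
        prob (Function.update p e 0) (avoidAll ends a₂ (insert a₁ {v}) ∩ connEvent ends a₂ z) ∧
      prob (Function.update p e 1)
          (avoidAll ends a₂ {a₁} ∩ (connEvent ends a₁ v ∩ connEvent ends a₂ z)) =
        prob (Function.update p e 0) (avoidAll ends a₂ (insert a₁ {v}) ∩ connEvent ends a₂ z) := by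
  have hπ : ∀ e' ∈ ({e} : Finset E), ∀ x, x ∈ ends e' → x = a₁ ∨ x ∈ ({v} : Finset V) := by
    intro e' he' x hx
    rw [Finset.mem_singleton] at he'
    subst he'
    rw [he, Sym2.mem_iff] at hx
    rcases hx with rfl | rfl
    · exact Or.inl rfl
    · exact Or.inr (Finset.mem_singleton_self x)
  have hdep := dependsOn_avoid_conn (ends := ends) hπ a₂ z
  obtain ⟨h1, h2⟩ := inter_supp_update_one_eq p he a₂ (connEvent ends a₂ z)
  refine ⟨?_, ?_⟩
  · rw [prob_congr_supp _ h2]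
    exact prob_update_one_eq_update_zero_of_dependsOn p e hdep
  · rw [prob_congr_supp _ h1]
    exact prob_update_one_eq_update_zero_of_dependsOn p e hdep

omit [LinearOrder R] [IsStrictOrderedRing R] in
/-- The `Q`-mass of `p[e ↦ 1]`: `P¹(Q) = P⁰(Q, v ∉ K)`. -/
lemma prob_update_one_Q (p : E → R) {e : E} {a₁ v : V} (he : ends e = s(a₁, v)) (a₂ : V) :
    prob (Function.update p e 1) (avoidAll ends a₂ {a₁}) =
      prob (Function.update p e 0) (avoidAll ends a₂ (insert a₁ {v})) := by
  have hπ : ∀ e' ∈ ({e} : Finset E), ∀ x, x ∈ ends e' → x = a₁ ∨ x ∈ ({v} : Finset V) := by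
    intro e' he' x hx
    rw [Finset.mem_singleton] at he'
    subst he'
    rw [he, Sym2.mem_iff] at hx
    rcases hx with rfl | rfl
    · exact Or.inl rfl
    · exact Or.inr (Finset.mem_singleton_self x)
  have hdep := dependsOn_avoid (ends := ends) hπ a₂
  obtain ⟨-, h2⟩ := inter_supp_update_one_eq p he a₂ Set.univ
  simp only [Set.inter_univ] at h2
  rw [prob_congr_supp _ h2]
  exact prob_update_one_eq_update_zero_of_dependsOn p e hdep

omit [LinearOrder R] [IsStrictOrderedRing R] in
/-- The `Dv`-mass of `p[e ↦ 1]`: `P¹(Q, a₁ ↔ v, o, b ∈ K) = P⁰(Q, v ∉ K, o, b ∈ K)`. -/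
lemma prob_update_one_Dv (p : E → R) {e : E} {a₁ v : V} (he : ends e = s(a₁, v)) (a₂ o b : V) :
    prob (Function.update p e 1)
        (avoidAll ends a₂ {a₁} ∩ (connEvent ends a₁ v ∩ (connEvent ends a₂ o ∩ connEvent ends a₂ b))) =
      prob (Function.update p e 0)
        (avoidAll ends a₂ (insert a₁ {v}) ∩ (connEvent ends a₂ o ∩ connEvent ends a₂ b)) := by
  have hπ : ∀ e' ∈ ({e} : Finset E), ∀ x, x ∈ ends e' → x = a₁ ∨ x ∈ ({v} : Finset V) := by
    intro e' he' x hx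
    rw [Finset.mem_singleton] at he'
    subst he'
    rw [he, Sym2.mem_iff] at hx
    rcases hx with rfl | rfl
    · exact Or.inl rfl
    · exact Or.inr (Finset.mem_singleton_self x)
  obtain ⟨h1, -⟩ := inter_supp_update_one_eq p he a₂
    (connEvent ends a₂ o ∩ connEvent ends a₂ b)
  rw [prob_congr_supp _ h1, connEvent_inter_eq_clusterInEvent_mem]
  exact prob_update_one_eq_update_zero_of_dependsOn p e
    (dependsOn_avoid_clusterIn (ends := ends) hπ a₂ _)

end Masses

section Main

variable {V : Type*} {E : Type*} [Fintype E] [DecidableEq E] [Fintype V] [DecidableEq V]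
  {R : Type*} [Field R] [LinearOrder R] [IsStrictOrderedRing R]
variable {ends : E → Sym2 V}

omit [Fintype V] [DecidableEq V] in
/-- The constant `C = q + (1 − q)·π̃₁₂` is admissible: `C ≤ P(a₁ ↔ v)`. -/
lemma const_le_pi (p : E → R) (hp : IsProbVec p) {π₁ π₂ : Finset E} {V₁ V₂ : Finset V}
    {a₁ v : V} {e : E} (he : ends e = s(a₁, v)) (hd : Disjoint π₁ π₂)
    (hconn₁ : ∀ ω ∈ allOpen π₁, ∀ x ∈ V₁, Conn ends ω a₁ x)
    (hconn₂ : ∀ ω ∈ allOpen π₂, ∀ x ∈ V₂, Conn ends ω a₁ x)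
    (hv₁ : v ∈ V₁) (hv₂ : v ∈ V₂) :
    p e + (1 - p e) *
        (∏ e' ∈ π₁, Function.update p e 0 e' + ∏ e' ∈ π₂, Function.update p e 0 e' -
          (∏ e' ∈ π₁, Function.update p e 0 e') * ∏ e' ∈ π₂, Function.update p e 0 e') ≤
      prob p (connEvent ends a₁ v) := by
  rw [prob_eq_pin p _ e]
  have h1 : prob (Function.update p e 1) (connEvent ends a₁ v) = 1 := by
    have hcongr : prob (Function.update p e 1) (connEvent ends a₁ v) =
        prob (Function.update p e 1) Set.univ := by
      apply prob_congr_supp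
      ext ω
      simp only [Set.mem_inter_iff, Set.mem_univ, true_and, and_iff_right_iff_imp]
      intro hs
      exact conn_of_mem_supp_update_one p he hs
    rw [hcongr, prob_univ]
  have h0 : ∏ e' ∈ π₁, Function.update p e 0 e' + ∏ e' ∈ π₂, Function.update p e 0 e' -
      (∏ e' ∈ π₁, Function.update p e 0 e') * ∏ e' ∈ π₂, Function.update p e 0 e' ≤
      prob (Function.update p e 0) (connEvent ends a₁ v) := by
    rw [← prob_allOpen_union (Function.update p e 0) hd]
    refine prob_mono (hp.update e le_rfl zero_le_one) fun ω hω => ?_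
    rcases hω with h | h
    · exact hconn₁ ω h v hv₁
    · exact hconn₂ ω h v hv₂
  rw [h1]
  have hq' : 0 ≤ 1 - p e := by linarith [hp.le_one e]
  nlinarith [mul_le_mul_of_nonneg_left h0 hq']

/-- **A two-route core plus one free `a₁`–`v` edge: the sign of `crossA′so`.**  The hypotheses are
those of `CrossAPrimeTwoRoutes.crossA'so_nonneg_of_twoRoutes` for the graph with `e` closed (the
route dictionary and the absorption hypotheses on `supp (p[e ↦ 0])`), `e = {a₁, v}`; the route
probabilities are those of `p[e ↦ 0]`, so `e` need not be kept off the routes explicitly. -/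
theorem crossA'so_nonneg_of_twoRoutes_freeEdge (p : E → R) (hp : IsProbVec p)
    {π₁ π₂ τ₁ τ₂ : Finset E} {V₁ V₂ : Finset V} {o a₁ a₂ v b : V} {e : E}
    (he : ends e = s(a₁, v))
    (hd : Disjoint π₁ π₂)
    (hπ₁ : ∀ e ∈ π₁, ∀ x, x ∈ ends e → x = a₁ ∨ x ∈ V₁)
    (hπ₂ : ∀ e ∈ π₂, ∀ x, x ∈ ends e → x = a₁ ∨ x ∈ V₂)
    (hconn₁ : ∀ ω ∈ allOpen π₁, ∀ x ∈ V₁, Conn ends ω a₁ x)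
    (hconn₂ : ∀ ω ∈ allOpen π₂, ∀ x ∈ V₂, Conn ends ω a₁ x)
    (hv₁ : v ∈ V₁) (hv₂ : v ∈ V₂) (ho : o ∈ V₁) (hb : b ∈ V₂)
    (hroute : ∀ ω ∈ supp (Function.update p e 0), ω ∈ avoidAll ends a₂ {a₁} →
      (ω ∈ connEvent ends a₁ v ↔ ω ∈ allOpen π₁ ∪ allOpen π₂))
    (hτ₁ : τ₁ ⊆ π₁) (hτ₂ : τ₂ ⊆ π₂)
    (htail₁ : ∀ ω ∈ allOpen τ₁, Conn ends ω o v) (htail₂ : ∀ ω ∈ allOpen τ₂, Conn ends ω b v)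
    (hsep₁ : ∀ ω ∈ supp (Function.update p e 0), ω ∈ avoidAll ends a₂ {a₁} →
      ω ∈ connEvent ends a₂ o → Conn ends (forceOpen τ₁ ω) a₂ a₁ → ω ∈ allOpen π₂)
    (hsep₂ : ∀ ω ∈ supp (Function.update p e 0), ω ∈ avoidAll ends a₂ {a₁} →
      ω ∈ connEvent ends a₂ b → Conn ends (forceOpen τ₂ ω) a₂ a₁ → ω ∈ allOpen π₁) :
    0 ≤ crossA'so p ends o a₁ a₂ v b := by
  classical
  set q₀ := Function.update p e 0 with hq₀def
  set q₁ := Function.update p e 1 with hq₁def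
  have hq₀ : IsProbVec q₀ := hp.update e le_rfl zero_le_one
  set P₁ := ∏ e' ∈ π₁, q₀ e' with hP₁def
  set P₂ := ∏ e' ∈ π₂, q₀ e' with hP₂def
  have hP₁0 : 0 ≤ P₁ := Finset.prod_nonneg fun e _ => hq₀.nonneg e
  have hP₂0 : 0 ≤ P₂ := Finset.prod_nonneg fun e _ => hq₀.nonneg e
  have hP₁1 : P₁ ≤ 1 := Finset.prod_le_one (fun e _ => hq₀.nonneg e) (fun e _ => hq₀.le_one e)
  have hP₂1 : P₂ ≤ 1 := Finset.prod_le_one (fun e _ => hq₀.nonneg e) (fun e _ => hq₀.le_one e)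
  set C := p e + (1 - p e) * (P₁ + P₂ - P₁ * P₂) with hCdef
  -- the constant is admissible
  have hC : C ≤ prob p (connEvent ends a₁ v) :=
    const_le_pi p hp he hd hconn₁ hconn₂ hv₁ hv₂
  refine crossA'so_nonneg_of_crossC hp o a₁ a₂ v b hC ?_
  -- the quadratic along `e`
  rw [crossC_pin_quadratic p C ends e o a₁ a₂ v b, ← crossC_eq_crossPatC]
  -- the masses
  set Q := avoidAll ends a₂ {a₁} with hQ
  set Qv := avoidAll ends a₂ (insert a₁ {v}) with hQv
  set oH := connEvent ends a₂ o
  set bH := connEvent ends a₂ b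
  set vH := connEvent ends a₂ v
  set L := connEvent ends a₁ v
  -- the two-route theorem for `q₀` at the constant `π̃₁₂`
  have htwo : 0 ≤ crossC q₀ (P₁ + P₂ - P₁ * P₂) ends o a₁ a₂ v b :=
    crossC_nonneg_of_twoRoutes_supp q₀ hq₀ hπ₁ hπ₂ hconn₁ hconn₂ hv₁ hv₂ ho hb hroute hτ₁ hτ₂
      htail₁ htail₂ hsep₁ hsep₂
  have hDv0 : prob q₀ (Q ∩ (L ∩ (oH ∩ bH))) = 0 :=
    prob_Dv_eq_zero_supp q₀ hconn₁ hconn₂ ho hb hroute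
  have hxv0 : prob q₀ (Q ∩ (L ∩ oH)) ≤ P₂ * prob q₀ (Q ∩ oH ∩ vHᶜ) :=
    prob_xv_le_supp q₀ hq₀ hπ₂ hconn₁ hconn₂ ho hv₂ hroute
  have hyv0 : prob q₀ (Q ∩ (L ∩ bH)) ≤ P₁ * prob q₀ (Q ∩ bH ∩ vHᶜ) :=
    prob_yv_le_supp q₀ hq₀ hπ₁ hconn₁ hconn₂ hb hv₁ hroute
  -- the `v ∉ K` masses in the two spellings
  have eu : Q ∩ oH ∩ vHᶜ = Qv ∩ oH := by
    rw [hQv, avoidAll_pair_eq, Set.inter_right_comm]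
  have ew : Q ∩ bH ∩ vHᶜ = Qv ∩ bH := by
    rw [hQv, avoidAll_pair_eq, Set.inter_right_comm]
  rw [eu] at hxv0
  rw [ew] at hyv0
  -- the masses of `q₁`
  obtain ⟨hx1, hxv1⟩ := prob_update_one_conn p he a₂ o
  obtain ⟨hy1, hyv1⟩ := prob_update_one_conn p he a₂ b
  have hZ1 := prob_update_one_Q p he a₂
  have hDv1 := prob_update_one_Dv p he a₂ o b
  -- BHK with the avoidance of `{a₁, v}`
  have hbhk : prob q₀ (Qv ∩ oH) * prob q₀ (Qv ∩ bH) ≤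
      prob q₀ (Qv ∩ (oH ∩ bH)) * prob q₀ Qv := by
    have key := bhk_same_cluster_events_avoid q₀ hq₀ ends a₂ (insert a₁ {v})
      (isUpperSet_mem_set (V := V) o) (isUpperSet_mem_set (V := V) b)
    rw [← connEvent_eq_clusterInEvent_mem, ← connEvent_eq_clusterInEvent_mem,
      ← connEvent_inter_eq_clusterInEvent_mem, Set.inter_comm (connEvent ends a₂ o),
      Set.inter_comm (connEvent ends a₂ b), Set.inter_comm (connEvent ends a₂ o ∩ _)] at key
    exact key
  -- `s ≤ Z⁰`, `u ≤ x⁰`, `w ≤ y⁰`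
  have hs : prob q₀ Qv ≤ prob q₀ Q := by
    refine prob_mono hq₀ fun ω h x hx => ?_
    rw [Finset.mem_singleton] at hx
    rw [hx]
    exact h a₁ (Finset.mem_insert_self a₁ {v})
  have hu : prob q₀ (Qv ∩ oH) ≤ prob q₀ (Q ∩ oH) := by
    refine prob_mono hq₀ fun ω h => ⟨fun x hx => ?_, h.2⟩
    rw [Finset.mem_singleton] at hx
    rw [hx]
    exact h.1 a₁ (Finset.mem_insert_self a₁ {v})
  have hw : prob q₀ (Qv ∩ bH) ≤ prob q₀ (Q ∩ bH) := by
    refine prob_mono hq₀ fun ω h => ⟨fun x hx => ?_, h.2⟩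
    rw [Finset.mem_singleton] at hx
    rw [hx]
    exact h.1 a₁ (Finset.mem_insert_self a₁ {v})
  -- assemble
  unfold crossC at htwo
  unfold crossC crossPatC
  rw [hDv0] at htwo
  rw [hx1, hxv1, hy1, hyv1, hZ1, hDv1, hDv0]
  exact freeEdge_algebra (hp.nonneg e) (hp.le_one e) hP₁0 hP₁1 hP₂0 hP₂1 hs
    (prob_nonneg hq₀ _) (prob_nonneg hq₀ _) (prob_nonneg hq₀ _) hu hw hxv0 hyv0 hbhk htwo

end Main

end CrossAPrimeFreeEdge

end Summit.Ventures.PercRepro2
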